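/-
Copyright (c) 2026. All rights reserved.
Released under Apache 2.0 license as described in the file LICENSE.
Authors: HodgeCM publication cell (pub-hodgecm), model-construction sub-cell, construction prover `mc-theta-1` (gen 3).
-/
import Literature.RepresentationTheory.KonnoKonno2007.RealUnitaryDualPairSL2
import Literature.Analysis.SegalBargmann.SchwartzLeviContinuity
import HarnessLib

/-!
# The hyperbolic one-parameter family of the real unitary dual pair acts continuously on Schwartz space

Topic `RepresentationTheory/KonnoKonno2007`; namespace `Literature.RepresentationTheory.KonnoKonno2007.RealDualPair`.
KERNEL ONLY (0 records).

Setting of `RealUnitaryDualPairSL2`: the real unitary dual pair `U(P,Q) × U(R,S)` seen in `Sp(𝕎)`,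
`𝕎 = ℝ^{DPIdx} × ℝ^{DPIdx}`, through the junction `junction P Q R S`; a hyperbolic plane `{e_{p₀}, e_{q₀}}` of
`V` gives the embedded `SL(2,ℝ)` `φ R S p₀ q₀`, the Siegel frame `u = frameU R S p₀ q₀ ∈ U(DPIdx)` and the plane
projection `Π = planeProj R S p₀ q₀`.  The **hyperbolic one-parameter subgroup** is `a_t = φ (diag(e^t, e^{-t}))`,
and in the frame `u ι𝕎(a_t) u⁻¹` is the Levi element `m(δ_{e^t})`, `δ_c = 1 + (c − 1)Π` (the plane dilation;
`RealUnitaryDualPairSL2.frame_ιφ_slDiag_half` is the case `c = ½`).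

We construct the corresponding **one-parameter family of Schwartz operators**
`hypOp t = μ₀(u)⁻¹ ∘ leviS (δ_{e^t}) ∘ μ₀(u)` (`μ₀ = unitaryOpPi`, the restriction to `𝓢` of the metaplectic
action of `U(DPIdx)`, [Folland1989, Prop. (4.39)]; `leviS` the Levi dilations [Folland1989, (4.24)]) and prove:

* `planeDil`, `planeDil_mul`, `planeDil_dotProduct_symm`, `planeDil_symm_toCLM`, `continuous_planeDil_exp_symm` — the
  plane dilations form a one-parameter group of symmetric automorphisms, operator-norm continuous;
* `hypOp_add`, `hypOp_zero` — **group law** `hypOp (s + t) = hypOp s ∘ hypOp t`, `hypOp 0 = id`;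
* `continuous_hypOp_uncurry`, `continuous_hypOp_apply` — **joint continuity** of `(t, f) ↦ hypOp t f` in the
  Schwartz topology (from `SchwartzLeviContinuity.continuous_leviS_uncurry` and the continuity of `μ₀(u)^{±1}`);
* `frame_ιφ_slDiag` — the **frame identity** `u ι𝕎(φ D(a)) u⁻¹ = m(δ_a)` on phase space for every `a ≠ 0`
  (the general-`a` companion of `RealUnitaryDualPairSL2.frame_ιφ_slDiag_half`, same matrix proof);
* `hypOp_rhoS_ι𝕎`, `isPhaseCovariantS_hypOp` — **Heisenberg covariance** of `hypOp t` over the phase-space map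
  of `ι𝕎 (hyp t)` (via the explicit phase map `hypPhase t = realify u⁻¹ ∘ (δ_{e^t} × δ_{e^t}⁻¹) ∘ realify u` and
  the frame identity);
* `toL2_hypOp`, `liftsTo_hypOp`, `exists_liftsTo_hypOp` — `hypOp t` is the restriction to `𝓢` of the
  unitary `schrodingerU u⁻¹ ∘ leviL2 δ ∘ schrodingerU u` of `L²`.

This is the "A-part" of the `KAK` continuity argument for the archimedean Weil representation of the real-rank-one
groups `U(n,1)(ℝ)`: G. B. Folland, *Harmonic Analysis in Phase Space*, Ch. 4 §2–§3 [Folland1989]; the smooth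
vectors `𝓢`: [ReedSimonI1980, §V.3].  All statements are kernel facts about tree definitions (`folklore`).

References: [Folland1989] Ch. 4 (4.24), Prop. (4.39); [KonnoKonno2007] §3.3; [ReedSimonI1980] §V.3.
-/

set_option autoImplicit false

noncomputable section

open Matrix Complex MeasureTheory
open scoped Kronecker ComplexConjugate
open Literature.Analysis.SegalBargmann Literature.RepresentationTheory.HeisenbergGroup
open Literature.NumberTheory.Automorphic Literature.NumberTheory.Automorphic.UnitaryGroup
open Literature.LinearAlgebra.Matrix Literature.LinearAlgebra.Matrix.RotationThreeShears

local notation "SR" σ => SchwartzMap (σ → ℝ) ℂ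
local notation "L2R" σ => Lp ℂ 2 (volume : Measure (σ → ℝ))

namespace Literature.RepresentationTheory.KonnoKonno2007

namespace RealDualPair

/-! ## 1. Invertible diagonal maps -/

section DiagEquiv

variable {σ : Type*}

/-- the diagonal automorphism `x ↦ (c_k x_k)_k` of `ℝ^σ` for nowhere-vanishing `c`, inverse the diagonal map of
`c⁻¹`. [folklore] -/
def diagEquiv (c : σ → ℝ) (hc : ∀ k, c k ≠ 0) : (σ → ℝ) ≃ₗ[ℝ] (σ → ℝ) :=
  { diagLin c with
    invFun := diagLin fun k => (c k)⁻¹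
    left_inv := fun x => funext fun k => by
      show (c k)⁻¹ * (c k * x k) = x k
      rw [inv_mul_cancel_left₀ (hc k)]
    right_inv := fun x => funext fun k => by
      show c k * ((c k)⁻¹ * x k) = x k
      rw [mul_inv_cancel_left₀ (hc k)] }

/-- unfolding `diagEquiv`. [folklore] -/
@[simp] theorem diagEquiv_apply (c : σ → ℝ) (hc : ∀ k, c k ≠ 0) (x : σ → ℝ) (k : σ) :
    diagEquiv c hc x k = c k * x k := rfl

/-- unfolding `(diagEquiv c)⁻¹`. [folklore] -/
@[simp] theorem diagEquiv_symm_apply (c : σ → ℝ) (hc : ∀ k, c k ≠ 0) (x : σ → ℝ) (k : σ) :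
    (diagEquiv c hc).symm x k = (c k)⁻¹ * x k := rfl

/-- diagonal automorphisms multiply coordinatewise. [folklore] -/
theorem diagEquiv_mul (c d : σ → ℝ) (hc : ∀ k, c k ≠ 0) (hd : ∀ k, d k ≠ 0) :
    diagEquiv c hc * diagEquiv d hd = diagEquiv (fun k => c k * d k) (fun k => mul_ne_zero (hc k) (hd k)) :=
  LinearEquiv.ext fun x => funext fun k => by
    rw [LinearEquiv.mul_apply, diagEquiv_apply, diagEquiv_apply, diagEquiv_apply, mul_assoc]

/-- `a x · a⁻¹ y = x · y` for a diagonal `a` (diagonal maps are symmetric). [folklore] -/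
theorem diagEquiv_dotProduct_symm [Fintype σ] (c : σ → ℝ) (hc : ∀ k, c k ≠ 0) (x y : σ → ℝ) :
    diagEquiv c hc x ⬝ᵥ (diagEquiv c hc).symm y = x ⬝ᵥ y := by
  simp only [dotProduct, diagEquiv_apply, diagEquiv_symm_apply]
  exact Finset.sum_congr rfl fun k _ => by
    calc c k * x k * ((c k)⁻¹ * y k) = (c k * (c k)⁻¹) * (x k * y k) := by ring
      _ = x k * y k := by rw [mul_inv_cancel₀ (hc k), one_mul]

end DiagEquiv

/-! ## 2. The plane dilations `δ_c = 1 + (c − 1)Π` -/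

section PlaneDil

variable {P Q : Type*} [Fintype P] [DecidableEq P] [Fintype Q] [DecidableEq Q]
  (R S : Type*) [Fintype R] [DecidableEq R] [Fintype S] [DecidableEq S] (p₀ : P) (q₀ : Q)

omit [Fintype P] [Fintype Q] [Fintype R] [DecidableEq R] [Fintype S] [DecidableEq S] in
/-- the plane indicator takes the values `0` and `1`. [folklore] -/
theorem planeInd_eq_zero_or_one (k : DPIdx P Q R S) : planeInd R S p₀ q₀ k = 0 ∨ planeInd R S p₀ q₀ k = 1 := by
  rcases k with ((⟨p, r⟩ | ⟨q, s⟩) | (⟨p, s⟩ | ⟨q, r⟩))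
  · rw [planeInd_ll]; split_ifs <;> simp
  · rw [planeInd_lr]; split_ifs <;> simp
  · rw [planeInd_rl]; split_ifs <;> simp
  · rw [planeInd_rr]; split_ifs <;> simp

/-- the dilation weight: `c` on the plane coordinates, `1` off the plane. [folklore] -/
def dilWt (c : ℝ) (k : DPIdx P Q R S) : ℝ := 1 + (c - 1) * planeInd R S p₀ q₀ k

omit [Fintype P] [Fintype Q] [Fintype R] [DecidableEq R] [Fintype S] [DecidableEq S] in
/-- `dilWt c k ∈ {1, c}`. [folklore] -/
theorem dilWt_eq_one_or_eq (c : ℝ) (k : DPIdx P Q R S) : dilWt R S p₀ q₀ c k = 1 ∨ dilWt R S p₀ q₀ c k = c := by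
  rcases planeInd_eq_zero_or_one R S p₀ q₀ k with h | h
  · left; rw [dilWt, h, mul_zero, add_zero]
  · right; rw [dilWt, h, mul_one, add_sub_cancel]

omit [Fintype P] [Fintype Q] [Fintype R] [DecidableEq R] [Fintype S] [DecidableEq S] in
/-- the weights do not vanish for `c ≠ 0`. [folklore] -/
theorem dilWt_ne_zero {c : ℝ} (hc : c ≠ 0) (k : DPIdx P Q R S) : dilWt R S p₀ q₀ c k ≠ 0 := by
  rcases dilWt_eq_one_or_eq R S p₀ q₀ c k with h | h
  · rw [h]; exact one_ne_zero
  · rw [h]; exact hc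

omit [Fintype P] [Fintype Q] [Fintype R] [DecidableEq R] [Fintype S] [DecidableEq S] in
/-- the weights are multiplicative in `c` (`Π² = Π`). [folklore] -/
theorem dilWt_mul (c d : ℝ) (k : DPIdx P Q R S) :
    dilWt R S p₀ q₀ c k * dilWt R S p₀ q₀ d k = dilWt R S p₀ q₀ (c * d) k := by
  rcases planeInd_eq_zero_or_one R S p₀ q₀ k with h | h <;> simp only [dilWt, h] <;> ring

omit [Fintype P] [Fintype Q] [Fintype R] [DecidableEq R] [Fintype S] [DecidableEq S] in
/-- the inverse weight is the weight of `c⁻¹`. [folklore] -/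
theorem dilWt_inv (c : ℝ) (k : DPIdx P Q R S) : (dilWt R S p₀ q₀ c k)⁻¹ = dilWt R S p₀ q₀ c⁻¹ k := by
  rcases planeInd_eq_zero_or_one R S p₀ q₀ k with h | h
  · simp only [dilWt, h, mul_zero, add_zero, inv_one]
  · simp only [dilWt, h, mul_one, add_sub_cancel]

omit [Fintype P] [Fintype Q] [Fintype R] [DecidableEq R] [Fintype S] [DecidableEq S] in
/-- `dilWt 1 = 1`. [folklore] -/
@[simp] theorem dilWt_one (k : DPIdx P Q R S) : dilWt R S p₀ q₀ 1 k = 1 := by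
  rw [dilWt, sub_self, zero_mul, add_zero]

/-- **The plane dilation `δ_c = 1 + (c − 1)Π`** (`c ≠ 0`): multiplication by `c` on the `2(|R| + |S|)` plane
coordinates, the identity off the plane. [folklore] -/
def planeDil (c : ℝ) (hc : c ≠ 0) : (DPIdx P Q R S → ℝ) ≃ₗ[ℝ] (DPIdx P Q R S → ℝ) :=
  diagEquiv (dilWt R S p₀ q₀ c) (dilWt_ne_zero R S p₀ q₀ hc)

omit [Fintype P] [Fintype Q] [Fintype R] [DecidableEq R] [Fintype S] [DecidableEq S] in
/-- unfolding `planeDil` coordinatewise. [folklore] -/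
@[simp] theorem planeDil_apply (c : ℝ) (hc : c ≠ 0) (x : DPIdx P Q R S → ℝ) (k : DPIdx P Q R S) :
    planeDil R S p₀ q₀ c hc x k = dilWt R S p₀ q₀ c k * x k := rfl

omit [Fintype P] [Fintype Q] [Fintype R] [DecidableEq R] [Fintype S] [DecidableEq S] in
/-- unfolding `(planeDil c)⁻¹` coordinatewise: it is the dilation by `c⁻¹`. [folklore] -/
@[simp] theorem planeDil_symm_apply (c : ℝ) (hc : c ≠ 0) (x : DPIdx P Q R S → ℝ) (k : DPIdx P Q R S) :
    (planeDil R S p₀ q₀ c hc).symm x k = dilWt R S p₀ q₀ c⁻¹ k * x k := by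
  rw [planeDil, diagEquiv_symm_apply, dilWt_inv]

omit [Fintype P] [Fintype Q] [Fintype R] [DecidableEq R] [Fintype S] [DecidableEq S] in
/-- `δ_c x = x + (c − 1) Π x`. [folklore] -/
theorem planeDil_apply_eq (c : ℝ) (hc : c ≠ 0) (x : DPIdx P Q R S → ℝ) :
    planeDil R S p₀ q₀ c hc x = x + (c - 1) • planeProj R S p₀ q₀ x := by
  funext k
  simp only [planeDil_apply, dilWt, Pi.add_apply, Pi.smul_apply, planeProj_apply, smul_eq_mul]
  ring

omit [Fintype P] [Fintype Q] [Fintype R] [DecidableEq R] [Fintype S] [DecidableEq S] in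
/-- `δ_c⁻¹ x = x + (c⁻¹ − 1) Π x`. [folklore] -/
theorem planeDil_symm_apply_eq (c : ℝ) (hc : c ≠ 0) (x : DPIdx P Q R S → ℝ) :
    (planeDil R S p₀ q₀ c hc).symm x = x + (c⁻¹ - 1) • planeProj R S p₀ q₀ x := by
  funext k
  simp only [planeDil_symm_apply, dilWt, Pi.add_apply, Pi.smul_apply, planeProj_apply, smul_eq_mul]
  ring

omit [Fintype P] [Fintype Q] [Fintype R] [DecidableEq R] [Fintype S] [DecidableEq S] in
/-- dependence on `c` only (proof-irrelevant congruence). [folklore] -/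
theorem planeDil_congr {a b : ℝ} (h : a = b) (ha : a ≠ 0) (hb : b ≠ 0) :
    planeDil R S p₀ q₀ a ha = planeDil R S p₀ q₀ b hb := by
  subst h; rfl

omit [Fintype P] [Fintype Q] [Fintype R] [DecidableEq R] [Fintype S] [DecidableEq S] in
/-- **One-parameter group law** `δ_a δ_b = δ_{ab}`. [folklore] -/
theorem planeDil_mul (a b : ℝ) (ha : a ≠ 0) (hb : b ≠ 0) :
    planeDil R S p₀ q₀ a ha * planeDil R S p₀ q₀ b hb = planeDil R S p₀ q₀ (a * b) (mul_ne_zero ha hb) :=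
  LinearEquiv.ext fun x => funext fun k => by
    rw [LinearEquiv.mul_apply, planeDil_apply, planeDil_apply, planeDil_apply, ← mul_assoc, dilWt_mul]

omit [Fintype P] [Fintype Q] [Fintype R] [DecidableEq R] [Fintype S] [DecidableEq S] in
/-- `δ_1 = 1`. [folklore] -/
theorem planeDil_one : planeDil R S p₀ q₀ 1 one_ne_zero = 1 :=
  LinearEquiv.ext fun x => funext fun k => by
    rw [planeDil_apply, dilWt_one, one_mul]
    rfl

omit [DecidableEq R] [DecidableEq S] in
/-- **`δ_c` is symmetric**: `δ_c x · δ_c⁻¹ y = x · y` (the hypothesis `had` of `leviS_rhoS`). [folklore] -/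
theorem planeDil_dotProduct_symm (c : ℝ) (hc : c ≠ 0) (x y : DPIdx P Q R S → ℝ) :
    planeDil R S p₀ q₀ c hc x ⬝ᵥ (planeDil R S p₀ q₀ c hc).symm y = x ⬝ᵥ y :=
  diagEquiv_dotProduct_symm _ _ x y

omit [DecidableEq R] [DecidableEq S] in
/-- **`δ_c⁻¹` as a continuous linear map is `1 + (c⁻¹ − 1)Π`.** [folklore] -/
theorem planeDil_symm_toCLM (c : ℝ) (hc : c ≠ 0) :
    (((planeDil R S p₀ q₀ c hc).symm.toContinuousLinearEquiv :
        (DPIdx P Q R S → ℝ) ≃L[ℝ] (DPIdx P Q R S → ℝ)) : (DPIdx P Q R S → ℝ) →L[ℝ] (DPIdx P Q R S → ℝ)) =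
      1 + (c⁻¹ - 1) • LinearMap.toContinuousLinearMap (planeProj R S p₀ q₀) := by
  refine ContinuousLinearMap.ext fun x => ?_
  rw [ContinuousLinearEquiv.coe_coe, LinearEquiv.coe_toContinuousLinearEquiv', planeDil_symm_apply_eq]
  rfl

omit [DecidableEq R] [DecidableEq S] in
/-- **operator-norm continuity of `t ↦ δ_{e^t}⁻¹`.** [folklore] -/
theorem continuous_planeDil_exp_symm :
    Continuous fun t : ℝ =>
      (((planeDil R S p₀ q₀ (Real.exp t) (Real.exp_pos t).ne').symm.toContinuousLinearEquiv :
        (DPIdx P Q R S → ℝ) ≃L[ℝ] (DPIdx P Q R S → ℝ)) : (DPIdx P Q R S → ℝ) →L[ℝ] (DPIdx P Q R S → ℝ)) := by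
  simp only [planeDil_symm_toCLM]
  exact continuous_const.add
    (((Real.continuous_exp.inv₀ fun t => (Real.exp_pos t).ne').sub continuous_const).smul continuous_const)

end PlaneDil

/-! ## 3. The frame identity for the hyperbolic torus `D(a)` -/

section FrameDiag

variable {P Q : Type*} [Fintype P] [DecidableEq P] [Fintype Q] [DecidableEq Q]
  (R S : Type*) [Fintype R] [DecidableEq R] [Fintype S] [DecidableEq S] (p₀ : P) (q₀ : Q)

/-- the Cayley conjugate of `D(a) = diag(a, a⁻¹)`: entry `(0,0)` is `(a + a⁻¹)/2`. [folklore] -/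
theorem cay_diag_00 (a : ℝ) : cay !![a, 0; 0, a⁻¹] 0 0 = (((a + a⁻¹) / 2 : ℝ) : ℂ) := by
  apply Complex.ext <;> simp [cay]
/-- entry `(0,1)` of `cay D(a)` is `((a⁻¹ − a)/2)·i`. [folklore] -/
theorem cay_diag_01 (a : ℝ) : cay !![a, 0; 0, a⁻¹] 0 1 = (((a⁻¹ - a) / 2 : ℝ) : ℂ) * I := by
  apply Complex.ext <;> simp [cay]
/-- entry `(1,0)` of `cay D(a)` is `((a − a⁻¹)/2)·i`. [folklore] -/
theorem cay_diag_10 (a : ℝ) : cay !![a, 0; 0, a⁻¹] 1 0 = (((a - a⁻¹) / 2 : ℝ) : ℂ) * I := by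
  apply Complex.ext <;> simp [cay]
/-- entry `(1,1)` of `cay D(a)` is `(a + a⁻¹)/2`. [folklore] -/
theorem cay_diag_11 (a : ℝ) : cay !![a, 0; 0, a⁻¹] 1 1 = (((a + a⁻¹) / 2 : ℝ) : ℂ) := by
  apply Complex.ext <;> simp [cay]

/-- **`hιd(a)`: in the frame, `ι𝕎 (φ D(a))` is the Levi element `(p, q) ↦ (p + (a − 1)Πp, q + (a⁻¹ − 1)Πq)`**
(`RealUnitaryDualPairSL2.frame_ιφ_slDiag_half` is `a = ½`). [folklore] -/
theorem frame_ιφ_slDiag (a : ℝ) (ha : a ≠ 0) (p q : DPIdx P Q R S → ℝ) :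
    (realifySp (DPIdx P Q R S) (frameU R S p₀ q₀) *
          (junction P Q R S).ι𝕎 (φ R S p₀ q₀ (slDiag a ha)) *
        (realifySp (DPIdx P Q R S) (frameU R S p₀ q₀))⁻¹).1 (p, q) =
      (p + (a - 1) • planeProj R S p₀ q₀ p, q + (a⁻¹ - 1) • planeProj R S p₀ q₀ q) := by
  apply pv_ext
  rw [phasePt_frame_conj, coe_slDiag]
  funext k
  rcases k with ((⟨p', r⟩ | ⟨q', s⟩) | (⟨p', s⟩ | ⟨q', r⟩))
  · rw [frame_mulVec_ll]
    by_cases hp : p' = p₀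
    · subst hp
      simp only [if_true, twMulVec, tw_inl, tw_inr, big_mulVec_ll, big_mulVec_rr, frameAdj_mulVec_ll,
        frameAdj_mulVec_rr, cay_diag_00, cay_diag_01, cay_diag_10, cay_diag_11,
        phasePt_apply, Pi.add_apply, Pi.smul_apply, smul_eq_mul, planeProj_apply, planeInd_ll,
        Complex.star_def, map_add, map_sub, map_mul, map_neg, Complex.conj_ofReal, Complex.conj_I]
      apply Complex.ext <;> simp <;> ring
    · simp only [hp, if_false, twMulVec, tw_inl, big_mulVec_ll, frameAdj_mulVec_ll, star_star, phasePt_apply,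
        Pi.add_apply, Pi.smul_apply, smul_eq_mul, planeProj_apply, planeInd_ll]
      push_cast
      ring
  · rw [frame_mulVec_lr]
    by_cases hq : q' = q₀
    · subst hq
      simp only [if_true, twMulVec, tw_inl, tw_inr, big_mulVec_rl, big_mulVec_lr, frameAdj_mulVec_rl,
        frameAdj_mulVec_lr, cay_diag_00, cay_diag_01, cay_diag_10, cay_diag_11,
        phasePt_apply, Pi.add_apply, Pi.smul_apply, smul_eq_mul, planeProj_apply, planeInd_lr,
        Complex.star_def, map_add, map_sub, map_mul, map_neg, Complex.conj_ofReal, Complex.conj_I]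
      apply Complex.ext <;> simp <;> ring
    · simp only [hq, if_false, twMulVec, tw_inl, big_mulVec_lr, frameAdj_mulVec_lr, star_star, phasePt_apply,
        Pi.add_apply, Pi.smul_apply, smul_eq_mul, planeProj_apply, planeInd_lr]
      push_cast
      ring
  · rw [frame_mulVec_rl]
    by_cases hp : p' = p₀
    · subst hp
      simp only [if_true, twMulVec, tw_inl, tw_inr, big_mulVec_rl, big_mulVec_lr, frameAdj_mulVec_rl,
        frameAdj_mulVec_lr, cay_diag_00, cay_diag_01, cay_diag_10, cay_diag_11,
        phasePt_apply, Pi.add_apply, Pi.smul_apply, smul_eq_mul, planeProj_apply,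
        planeInd_rl, Complex.star_def, map_add, map_sub, map_mul, map_neg, Complex.conj_ofReal, Complex.conj_I]
      apply Complex.ext <;> simp <;> ring
    · simp only [hp, if_false, twMulVec, tw_inr, big_mulVec_rl, frameAdj_mulVec_rl, phasePt_apply, Pi.add_apply,
        Pi.smul_apply, smul_eq_mul, planeProj_apply, planeInd_rl]
      push_cast
      ring
  · rw [frame_mulVec_rr]
    by_cases hq : q' = q₀
    · subst hq
      simp only [if_true, twMulVec, tw_inl, tw_inr, big_mulVec_ll, big_mulVec_rr, frameAdj_mulVec_ll,
        frameAdj_mulVec_rr, cay_diag_00, cay_diag_01, cay_diag_10, cay_diag_11,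
        phasePt_apply, Pi.add_apply, Pi.smul_apply, smul_eq_mul, planeProj_apply,
        planeInd_rr, Complex.star_def, map_add, map_sub, map_mul, map_neg, Complex.conj_ofReal, Complex.conj_I]
      apply Complex.ext <;> simp <;> ring
    · simp only [hq, if_false, twMulVec, tw_inr, big_mulVec_rr, frameAdj_mulVec_rr, phasePt_apply, Pi.add_apply,
        Pi.smul_apply, smul_eq_mul, planeProj_apply, planeInd_rr]
      push_cast
      ring

/-- the frame identity in `planeDil` form: `u ι𝕎(φ D(c)) u⁻¹ = (δ_c × δ_c⁻¹)`. [folklore] -/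
theorem frame_ιφ_slDiag_planeDil (c : ℝ) (hc : c ≠ 0) (p q : DPIdx P Q R S → ℝ) :
    (realifySp (DPIdx P Q R S) (frameU R S p₀ q₀) *
          (junction P Q R S).ι𝕎 (φ R S p₀ q₀ (slDiag c hc)) *
        (realifySp (DPIdx P Q R S) (frameU R S p₀ q₀))⁻¹).1 (p, q) =
      (planeDil R S p₀ q₀ c hc p, (planeDil R S p₀ q₀ c hc).symm q) := by
  rw [frame_ιφ_slDiag, planeDil_apply_eq, planeDil_symm_apply_eq]

end FrameDiag

/-! ## 4. Covariance of `μ₀(u)` and the Levi family in the frame -/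

section Frame

variable {P Q : Type*} [Fintype P] [DecidableEq P] [Fintype Q] [DecidableEq Q]
  (R S : Type*) [Fintype R] [DecidableEq R] [Fintype S] [DecidableEq S] (p₀ : P) (q₀ : Q)

/-- **`μ₀(U)` implements `realify U` on `𝓢`** (binder-2's compact Weil representation with trivial character).
[cite: Folland1989, Prop. (4.39)] -/
theorem unitaryOpPi_rhoS {σ : Type*} [Fintype σ] [DecidableEq σ] (U : Matrix.unitaryGroup σ ℂ)
    (p q : σ → ℝ) (f : SR σ) :
    unitaryOpPi U (rhoS p q f) = rhoS (realify U (p, q)).1 (realify U (p, q)).2 (unitaryOpPi U f) := by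
  have h := isRhoCovariantS_compactWeilRep (MonoidHom.id (Matrix.unitaryGroup σ ℂ))
    (1 : Matrix.unitaryGroup σ ℂ →* Circle) U p q f
  simpa only [compactWeilRep_apply, MonoidHom.one_apply, Circle.coe_one, one_smul, MonoidHom.id_apply] using h

/-- **The hyperbolic Levi family in the frame**: `hypLevi t = leviS (δ_{e^t})`. [cite: Folland1989, (4.24)] -/
def hypLevi (t : ℝ) : (SR (DPIdx P Q R S)) →L[ℂ] SR (DPIdx P Q R S) :=
  leviS (planeDil R S p₀ q₀ (Real.exp t) (Real.exp_pos t).ne')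

omit [DecidableEq R] [DecidableEq S] in
/-- group law of the Levi family. [folklore] -/
theorem hypLevi_add (s t : ℝ) :
    hypLevi R S p₀ q₀ (s + t) = (hypLevi R S p₀ q₀ s).comp (hypLevi R S p₀ q₀ t) := by
  rw [hypLevi, hypLevi, hypLevi, ← leviS_mul, planeDil_mul]
  rw [planeDil_congr R S p₀ q₀ (Real.exp_add s t)]

omit [DecidableEq R] [DecidableEq S] in
/-- `hypLevi 0 = id`. [folklore] -/
theorem hypLevi_zero : hypLevi R S p₀ q₀ 0 = ContinuousLinearMap.id ℂ (SR (DPIdx P Q R S)) := by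
  rw [hypLevi, planeDil_congr R S p₀ q₀ Real.exp_zero _ one_ne_zero, planeDil_one, leviS_one]

omit [DecidableEq R] [DecidableEq S] in
/-- **joint continuity of the Levi family** `(t, f) ↦ hypLevi t f`. [cite: Folland1989, (4.24)] -/
theorem continuous_hypLevi_uncurry :
    Continuous fun x : ℝ × SR (DPIdx P Q R S) => hypLevi R S p₀ q₀ x.1 x.2 := by
  show Continuous fun x : ℝ × SR (DPIdx P Q R S) =>
    leviS (planeDil R S p₀ q₀ (Real.exp x.1) (Real.exp_pos x.1).ne') x.2
  exact continuous_leviS_uncurry (a := fun t : ℝ => planeDil R S p₀ q₀ (Real.exp t) (Real.exp_pos t).ne')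
    (continuous_planeDil_exp_symm R S p₀ q₀)

omit [DecidableEq R] [DecidableEq S] in
/-- Heisenberg covariance of the Levi family: `hypLevi t` implements `(p, q) ↦ (δ p, δ⁻¹ q)`, `δ = δ_{e^t}`.
[cite: Folland1989, (4.24)] -/
theorem hypLevi_rhoS (t : ℝ) (p q : DPIdx P Q R S → ℝ) (f : SR (DPIdx P Q R S)) :
    hypLevi R S p₀ q₀ t (rhoS p q f) =
      rhoS (planeDil R S p₀ q₀ (Real.exp t) (Real.exp_pos t).ne' p)
        ((planeDil R S p₀ q₀ (Real.exp t) (Real.exp_pos t).ne').symm q) (hypLevi R S p₀ q₀ t f) :=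
  leviS_rhoS (planeDil_dotProduct_symm R S p₀ q₀ _ _) p q f

end Frame

/-! ## 5. The hyperbolic family `hypOp t = μ₀(u)⁻¹ ∘ leviS (δ_{e^t}) ∘ μ₀(u)` -/

section HypOp

variable {P Q : Type*} [Fintype P] [DecidableEq P] [Fintype Q] [DecidableEq Q]
  (R S : Type*) [Fintype R] [DecidableEq R] [Fintype S] [DecidableEq S] (p₀ : P) (q₀ : Q)

/-- **The hyperbolic one-parameter subgroup** `hyp t = φ (diag(e^t, e^{-t})) ∈ U(P,Q) × U(R,S)`. [folklore] -/
def hyp (t : ℝ) : Ginf P Q R S := φ R S p₀ q₀ (slDiag (Real.exp t) (Real.exp_pos t).ne')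

/-- `hyp t` as a pair: `(φV (diag(e^t, e^{-t})), 1)` — its `V`-component is the boost of `U(P,Q)` (the
carrier of the `KAK` decomposition), its `W`-component is trivial. [folklore] -/
theorem hyp_eq_pair (t : ℝ) :
    hyp R S p₀ q₀ t = ((φV p₀ q₀ (slDiag (Real.exp t) (Real.exp_pos t).ne'), 1) : Ginf P Q R S) := rfl

/-- the `V`-component of `hyp t`. [folklore] -/
@[simp] theorem hyp_fst (t : ℝ) : (hyp R S p₀ q₀ t).1 = φV p₀ q₀ (slDiag (Real.exp t) (Real.exp_pos t).ne') :=
  rfl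

/-- the `W`-component of `hyp t` is `1`. [folklore] -/
@[simp] theorem hyp_snd (t : ℝ) : (hyp R S p₀ q₀ t).2 = 1 := rfl

/-- `hyp t = inl (hyp t).1`: the family lies in the first factor. [folklore] -/
theorem hyp_eq_inl (t : ℝ) :
    hyp R S p₀ q₀ t = MonoidHom.inl (UForm P Q) (UForm R S) (φV p₀ q₀ (slDiag (Real.exp t) (Real.exp_pos t).ne')) :=
  rfl

/-- `diag(a, a⁻¹) diag(b, b⁻¹) = diag(ab, (ab)⁻¹)` in `SL(2,ℝ)`. [folklore] -/
theorem slDiag_mul_slDiag (a b : ℝ) (ha : a ≠ 0) (hb : b ≠ 0) :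
    slDiag a ha * slDiag b hb = slDiag (a * b) (mul_ne_zero ha hb) := by
  apply Subtype.ext
  rw [Matrix.SpecialLinearGroup.coe_mul, coe_slDiag, coe_slDiag, coe_slDiag]
  ext i j
  fin_cases i <;> fin_cases j <;> simp [Matrix.mul_apply, Fin.sum_univ_two, mul_comm]

/-- **group law** `hyp (s + t) = hyp s * hyp t`. [folklore] -/
theorem hyp_add (s t : ℝ) : hyp R S p₀ q₀ (s + t) = hyp R S p₀ q₀ s * hyp R S p₀ q₀ t := by
  rw [hyp, hyp, hyp, ← map_mul, slDiag_mul_slDiag]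
  congr 1
  apply Subtype.ext
  rw [coe_slDiag, coe_slDiag, Real.exp_add]

/-- **The hyperbolic family of Schwartz operators** `hypOp t = μ₀(u)⁻¹ ∘ leviS (δ_{e^t}) ∘ μ₀(u)`,
`u = frameU`. [cite: Folland1989, (4.24), Prop. (4.39)] -/
def hypOp (t : ℝ) : (SR (DPIdx P Q R S)) →L[ℂ] SR (DPIdx P Q R S) :=
  (unitaryOpPi (frameU R S p₀ q₀)⁻¹).comp ((hypLevi R S p₀ q₀ t).comp (unitaryOpPi (frameU R S p₀ q₀)))

/-- unfolding `hypOp`. [folklore] -/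
theorem hypOp_apply (t : ℝ) (f : SR (DPIdx P Q R S)) :
    hypOp R S p₀ q₀ t f =
      unitaryOpPi (frameU R S p₀ q₀)⁻¹ (hypLevi R S p₀ q₀ t (unitaryOpPi (frameU R S p₀ q₀) f)) := rfl

/-- `μ₀(u) ∘ μ₀(u⁻¹) = id` on `𝓢`. [folklore] -/
theorem unitaryOpPi_mul_inv_apply {σ : Type*} [Fintype σ] [DecidableEq σ] (U : Matrix.unitaryGroup σ ℂ)
    (f : SR σ) : unitaryOpPi U (unitaryOpPi U⁻¹ f) = f := by
  rw [← ContinuousLinearMap.comp_apply, ← unitaryOpPi_mul, mul_inv_cancel, unitaryOpPi_one,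
    ContinuousLinearMap.id_apply]

/-- `μ₀(u⁻¹) ∘ μ₀(u) = id` on `𝓢`. [folklore] -/
theorem unitaryOpPi_inv_mul_apply {σ : Type*} [Fintype σ] [DecidableEq σ] (U : Matrix.unitaryGroup σ ℂ)
    (f : SR σ) : unitaryOpPi U⁻¹ (unitaryOpPi U f) = f := by
  rw [← ContinuousLinearMap.comp_apply, ← unitaryOpPi_mul, inv_mul_cancel, unitaryOpPi_one,
    ContinuousLinearMap.id_apply]

/-- **Group law** `hypOp (s + t) = hypOp s ∘ hypOp t`. [folklore] -/
theorem hypOp_add (s t : ℝ) :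
    hypOp R S p₀ q₀ (s + t) = (hypOp R S p₀ q₀ s).comp (hypOp R S p₀ q₀ t) := by
  refine ContinuousLinearMap.ext fun f => ?_
  rw [ContinuousLinearMap.comp_apply, hypOp_apply, hypOp_apply, hypOp_apply, unitaryOpPi_mul_inv_apply,
    hypLevi_add, ContinuousLinearMap.comp_apply]

/-- pointwise group law `hypOp (s + t) f = hypOp s (hypOp t f)` (the `hWA_add` clause of the KAK assembly).
[folklore] -/
theorem hypOp_add_apply (s t : ℝ) (f : SR (DPIdx P Q R S)) :
    hypOp R S p₀ q₀ (s + t) f = hypOp R S p₀ q₀ s (hypOp R S p₀ q₀ t f) := by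
  rw [hypOp_add, ContinuousLinearMap.comp_apply]

/-- `hypOp 0 = id`. [folklore] -/
theorem hypOp_zero : hypOp R S p₀ q₀ 0 = ContinuousLinearMap.id ℂ (SR (DPIdx P Q R S)) := by
  refine ContinuousLinearMap.ext fun f => ?_
  rw [hypOp_apply, hypLevi_zero, ContinuousLinearMap.id_apply, unitaryOpPi_inv_mul_apply,
    ContinuousLinearMap.id_apply]

/-- `hypOp (−t)` is a two-sided inverse of `hypOp t`. [folklore] -/
theorem hypOp_neg_apply (t : ℝ) (f : SR (DPIdx P Q R S)) :
    hypOp R S p₀ q₀ (-t) (hypOp R S p₀ q₀ t f) = f := by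
  rw [← ContinuousLinearMap.comp_apply, ← hypOp_add, neg_add_cancel, hypOp_zero, ContinuousLinearMap.id_apply]

/-- `hypOp t (hypOp (−t) f) = f`. [folklore] -/
theorem hypOp_apply_neg (t : ℝ) (f : SR (DPIdx P Q R S)) :
    hypOp R S p₀ q₀ t (hypOp R S p₀ q₀ (-t) f) = f := by
  rw [← ContinuousLinearMap.comp_apply, ← hypOp_add, add_neg_cancel, hypOp_zero, ContinuousLinearMap.id_apply]

/-- **`hypOp t` as an automorphism of `𝓢`**, inverse `hypOp (−t)`. [folklore] -/
def hypOpEquiv (t : ℝ) : (SR (DPIdx P Q R S)) ≃L[ℂ] SR (DPIdx P Q R S) :=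
  ContinuousLinearEquiv.equivOfInverse (hypOp R S p₀ q₀ t) (hypOp R S p₀ q₀ (-t))
    (hypOp_neg_apply R S p₀ q₀ t) (hypOp_apply_neg R S p₀ q₀ t)

/-- unfolding. [folklore] -/
@[simp] theorem hypOpEquiv_apply (t : ℝ) (f : SR (DPIdx P Q R S)) :
    hypOpEquiv R S p₀ q₀ t f = hypOp R S p₀ q₀ t f := rfl

/-- **Joint continuity of `(t, f) ↦ hypOp t f`** in the Schwartz topology. [folklore] -/
theorem continuous_hypOp_uncurry :
    Continuous fun x : ℝ × SR (DPIdx P Q R S) => hypOp R S p₀ q₀ x.1 x.2 := by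
  have h1 : Continuous fun x : ℝ × SR (DPIdx P Q R S) => (x.1, unitaryOpPi (frameU R S p₀ q₀) x.2) :=
    continuous_fst.prodMk ((unitaryOpPi (frameU R S p₀ q₀)).continuous.comp continuous_snd)
  have h2 : Continuous fun x : ℝ × SR (DPIdx P Q R S) =>
      hypLevi R S p₀ q₀ x.1 (unitaryOpPi (frameU R S p₀ q₀) x.2) :=
    (continuous_hypLevi_uncurry R S p₀ q₀).comp h1
  exact (unitaryOpPi (frameU R S p₀ q₀)⁻¹).continuous.comp h2

/-- **Strong continuity**: every orbit map `t ↦ hypOp t f` is continuous. [folklore] -/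
theorem continuous_hypOp_apply (f : SR (DPIdx P Q R S)) : Continuous fun t : ℝ => hypOp R S p₀ q₀ t f :=
  (continuous_hypOp_uncurry R S p₀ q₀).uncurry_right f

/-- **The phase map of `hypOp t`**: `realify u⁻¹ ∘ (δ × δ⁻¹) ∘ realify u`, `δ = δ_{e^t}`. [folklore] -/
def hypPhase (t : ℝ) (w : (DPIdx P Q R S → ℝ) × (DPIdx P Q R S → ℝ)) :
    (DPIdx P Q R S → ℝ) × (DPIdx P Q R S → ℝ) :=
  realify (frameU R S p₀ q₀)⁻¹
    (planeDil R S p₀ q₀ (Real.exp t) (Real.exp_pos t).ne' (realify (frameU R S p₀ q₀) w).1,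
      (planeDil R S p₀ q₀ (Real.exp t) (Real.exp_pos t).ne').symm (realify (frameU R S p₀ q₀) w).2)

/-- **Heisenberg covariance of `hypOp t`** over `hypPhase t`. [cite: Folland1989, (4.24), Prop. (4.39)] -/
theorem hypOp_rhoS (t : ℝ) (p q : DPIdx P Q R S → ℝ) (f : SR (DPIdx P Q R S)) :
    hypOp R S p₀ q₀ t (rhoS p q f) =
      rhoS (hypPhase R S p₀ q₀ t (p, q)).1 (hypPhase R S p₀ q₀ t (p, q)).2 (hypOp R S p₀ q₀ t f) := by
  rw [hypOp_apply, hypOp_apply, unitaryOpPi_rhoS, hypLevi_rhoS, unitaryOpPi_rhoS]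
  rfl

/-- **The phase map is `ι𝕎 (hyp t)` given the frame identity** `u ι𝕎(φ D(e^t)) u⁻¹ = m(δ_{e^t})` on
phase space (the general-`c` companion of `RealUnitaryDualPairSL2.frame_ιφ_slDiag_half`). [folklore] -/
theorem hypPhase_eq_of_frame (t : ℝ)
    (hframe : ∀ p q : DPIdx P Q R S → ℝ,
      (realifySp (DPIdx P Q R S) (frameU R S p₀ q₀) *
            (junction P Q R S).ι𝕎 (φ R S p₀ q₀ (slDiag (Real.exp t) (Real.exp_pos t).ne')) *
          (realifySp (DPIdx P Q R S) (frameU R S p₀ q₀))⁻¹).1 (p, q) =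
        (planeDil R S p₀ q₀ (Real.exp t) (Real.exp_pos t).ne' p,
          (planeDil R S p₀ q₀ (Real.exp t) (Real.exp_pos t).ne').symm q))
    (w : (DPIdx P Q R S → ℝ) × (DPIdx P Q R S → ℝ)) :
    hypPhase R S p₀ q₀ t w =
      (((junction P Q R S).ι𝕎 (hyp R S p₀ q₀ t)).1 :
          ((DPIdx P Q R S → ℝ) × (DPIdx P Q R S → ℝ)) ≃ₗ[ℝ] ((DPIdx P Q R S → ℝ) × (DPIdx P Q R S → ℝ))) w := by
  obtain ⟨p, q⟩ := w
  rw [hyp]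
  have hw := hframe (realify (frameU R S p₀ q₀) (p, q)).1 (realify (frameU R S p₀ q₀) (p, q)).2
  rw [Prod.mk.eta, sp_mul_mul_apply, ← map_inv, coe_realifySp, coe_realifySp, ← realify_mul, inv_mul_cancel,
    realify_one] at hw
  have h2 := congrArg (realify (frameU R S p₀ q₀)⁻¹) hw
  rw [← realify_mul, inv_mul_cancel, realify_one] at h2
  rw [h2]
  rfl

/-- **Covariance over `ι𝕎 (hyp t)` from the frame identity**: `hypOp t` implements `ι𝕎 (hyp t)` as soon as
`u ι𝕎(φ D(e^t)) u⁻¹ = m(δ_{e^t})` on phase space. [cite: Folland1989, (4.24), Prop. (4.39)] -/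
theorem hypOp_rhoS_of_frame (t : ℝ)
    (hframe : ∀ p q : DPIdx P Q R S → ℝ,
      (realifySp (DPIdx P Q R S) (frameU R S p₀ q₀) *
            (junction P Q R S).ι𝕎 (φ R S p₀ q₀ (slDiag (Real.exp t) (Real.exp_pos t).ne')) *
          (realifySp (DPIdx P Q R S) (frameU R S p₀ q₀))⁻¹).1 (p, q) =
        (planeDil R S p₀ q₀ (Real.exp t) (Real.exp_pos t).ne' p,
          (planeDil R S p₀ q₀ (Real.exp t) (Real.exp_pos t).ne').symm q))
    (p q : DPIdx P Q R S → ℝ) (f : SR (DPIdx P Q R S)) :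
    hypOp R S p₀ q₀ t (rhoS p q f) =
      rhoS ((((junction P Q R S).ι𝕎 (hyp R S p₀ q₀ t)).1 :
              ((DPIdx P Q R S → ℝ) × (DPIdx P Q R S → ℝ)) ≃ₗ[ℝ] ((DPIdx P Q R S → ℝ) × (DPIdx P Q R S → ℝ)))
            (p, q)).1
        ((((junction P Q R S).ι𝕎 (hyp R S p₀ q₀ t)).1 :
              ((DPIdx P Q R S → ℝ) × (DPIdx P Q R S → ℝ)) ≃ₗ[ℝ] ((DPIdx P Q R S → ℝ) × (DPIdx P Q R S → ℝ)))
            (p, q)).2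
        (hypOp R S p₀ q₀ t f) := by
  rw [hypOp_rhoS, hypPhase_eq_of_frame R S p₀ q₀ t hframe (p, q)]

/-- **The phase map of `hypOp t` is `ι𝕎 (hyp t)`** (frame identity `frame_ιφ_slDiag`). [folklore] -/
theorem hypPhase_eq (t : ℝ) (w : (DPIdx P Q R S → ℝ) × (DPIdx P Q R S → ℝ)) :
    hypPhase R S p₀ q₀ t w =
      (((junction P Q R S).ι𝕎 (hyp R S p₀ q₀ t)).1 :
          ((DPIdx P Q R S → ℝ) × (DPIdx P Q R S → ℝ)) ≃ₗ[ℝ] ((DPIdx P Q R S → ℝ) × (DPIdx P Q R S → ℝ))) w :=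
  hypPhase_eq_of_frame R S p₀ q₀ t (frame_ιφ_slDiag_planeDil R S p₀ q₀ (Real.exp t) (Real.exp_pos t).ne') w

/-- **Heisenberg covariance of the hyperbolic family over `ι𝕎 (hyp t)`**: `hypOp t` implements the phase-space
map of `a_t = φ (diag(e^t, e^{-t}))` — the (w2) clause of an archimedean Weil datum along the split torus.
[cite: Folland1989, (4.24), Prop. (4.39)] -/
theorem hypOp_rhoS_ι𝕎 (t : ℝ) (p q : DPIdx P Q R S → ℝ) (f : SR (DPIdx P Q R S)) :
    hypOp R S p₀ q₀ t (rhoS p q f) =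
      rhoS ((((junction P Q R S).ι𝕎 (hyp R S p₀ q₀ t)).1 :
              ((DPIdx P Q R S → ℝ) × (DPIdx P Q R S → ℝ)) ≃ₗ[ℝ] ((DPIdx P Q R S → ℝ) × (DPIdx P Q R S → ℝ)))
            (p, q)).1
        ((((junction P Q R S).ι𝕎 (hyp R S p₀ q₀ t)).1 :
              ((DPIdx P Q R S → ℝ) × (DPIdx P Q R S → ℝ)) ≃ₗ[ℝ] ((DPIdx P Q R S → ℝ) × (DPIdx P Q R S → ℝ)))
            (p, q)).2
        (hypOp R S p₀ q₀ t f) := by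
  rw [hypOp_rhoS, hypPhase_eq R S p₀ q₀ t (p, q)]

/-- **`IsPhaseCovariantS` form**: the family `t ↦ hypOp t` is Heisenberg-covariant over the phase maps
`t ↦ ι𝕎 (hyp t)`. [cite: Folland1989, (4.24), Prop. (4.39)] -/
theorem isPhaseCovariantS_hypOp :
    IsPhaseCovariantS
      (fun t : ℝ => ⇑(((junction P Q R S).ι𝕎 (hyp R S p₀ q₀ t)).1 :
          ((DPIdx P Q R S → ℝ) × (DPIdx P Q R S → ℝ)) ≃ₗ[ℝ] ((DPIdx P Q R S → ℝ) × (DPIdx P Q R S → ℝ))))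
      (fun t : ℝ => (hypOp R S p₀ q₀ t : (SR (DPIdx P Q R S)) →ₗ[ℂ] SR (DPIdx P Q R S))) :=
  fun t p q f => hypOp_rhoS_ι𝕎 R S p₀ q₀ t p q f

/-- **The `L²` unitary of the hyperbolic family**: `schrodingerU u⁻¹ ∘ leviL2 (δ_{e^t}) ∘ schrodingerU u`.
[cite: Folland1989, (4.24), Prop. (4.39)] -/
def hypL2 (t : ℝ) : (L2R (DPIdx P Q R S)) ≃ₗᵢ[ℂ] L2R (DPIdx P Q R S) :=
  ((schrodingerU (frameU R S p₀ q₀)).trans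
      (leviL2 (planeDil R S p₀ q₀ (Real.exp t) (Real.exp_pos t).ne'))).trans
    (schrodingerU (frameU R S p₀ q₀)⁻¹)

/-- **`hypOp t` is the restriction to `𝓢` of the unitary `hypL2 t`.** [cite: Folland1989, (4.24), Prop. (4.39)] -/
theorem toL2_hypOp (t : ℝ) (f : SR (DPIdx P Q R S)) :
    toL2 (hypOp R S p₀ q₀ t f) = hypL2 R S p₀ q₀ t (toL2 f) := by
  rw [hypOp_apply, toL2_unitaryOpPi, hypLevi, toL2_leviS, toL2_unitaryOpPi]
  rfl

/-- `LiftsTo` form of `toL2_hypOp`. [cite: Folland1989, (4.24), Prop. (4.39)] -/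
theorem liftsTo_hypOp (t : ℝ) :
    LiftsTo (hypOp R S p₀ q₀ t : (SR (DPIdx P Q R S)) →ₗ[ℂ] SR (DPIdx P Q R S))
      ((hypL2 R S p₀ q₀ t).toContinuousLinearEquiv : (L2R (DPIdx P Q R S)) →L[ℂ] L2R (DPIdx P Q R S)) :=
  fun f => toL2_hypOp R S p₀ q₀ t f

/-- **(w2′) clause**: every `hypOp t` has a unitary lift to `L²`. [cite: Folland1989, (4.24), Prop. (4.39)] -/
theorem exists_liftsTo_hypOp (t : ℝ) :
    ∃ U : (L2R (DPIdx P Q R S)) ≃ₗᵢ[ℂ] L2R (DPIdx P Q R S),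
      LiftsTo (hypOp R S p₀ q₀ t : (SR (DPIdx P Q R S)) →ₗ[ℂ] SR (DPIdx P Q R S))
        (U.toContinuousLinearEquiv : (L2R (DPIdx P Q R S)) →L[ℂ] L2R (DPIdx P Q R S)) :=
  ⟨hypL2 R S p₀ q₀ t, liftsTo_hypOp R S p₀ q₀ t⟩

end HypOp

end RealDualPair

end Literature.RepresentationTheory.KonnoKonno2007

end
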